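import Summits.BirchSwinnertonDyer.BirchSwinnertonDyer.Theorems.EisensteinPrimesMazurMCOnCellBTwistbackConnectedPartnerZigzag
import Summits.BirchSwinnertonDyer.BirchSwinnertonDyer.Theorems.EisensteinPrimesMazurMCOnCellBTwistbackOnePartnerCertificates
import Summits.BirchSwinnertonDyer.BirchSwinnertonDyer.Theorems.EisensteinPrimesMazurMCOnCellBTwistbackSubrowPartnerOfSupplyPAdicGZ
import HarnessLib

/-!
# Crux 3 `MazurMCOnCellB` (stmt-BirchSwinnertonDyer-19033), line `twistback` v12 — TWO MORE DOORS INTO THE RIGHT DISJUNCT OF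
# THE REGISTERED STUB: road (c) at a SPLIT pair (one admissible `K` with the partner's `(μ_an, λ_an) = (0, 2)` and the typed
# exceptional leading term) and the SUPPLIED-FIELD road of sub-population (iii) (non-split, any odd `p`, a balance-one line datum
# plus `HeegnerFieldWithBernoulliUnit`) are connected partnered vertices; hence Mazur's main conjecture at those pairs

LEAD bsd-line-x2-p1 (gen 15), cell `bsd-eis`, 2026-08-29. `--supports stmt-BirchSwinnertonDyer-19033 --as helper`; the first
helpers landed under the END-STATE skeleton twistback v12 (sha256 540948e0…): its open stub 6⁷
`stub_offSubrow_connectedShaUnitOrPartner` asks, at every X2b pair off the sub-row, a connected Ш-unit class (left) OR a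
connected partnered vertex (right); a road is a Theorems-side door into a disjunct. HONEST FRAMING: THEOREMS ONLY (no `def`,
no named fact introduced, no `sorry`); every theorem is CONDITIONAL on the named facts it lists (PUBLISHED: `PublishedInputs`,
Disegni 2020 Thm. 4(1) / Thm. 2.4, Greenberg–Vatsal (3.11); plus Keller–Yin Thm. D (PRE) in §3) and on PER-PAIR READINGS / the
supply predicate taken as hypotheses (`r_an(E^{(d_K)}) = 1`, `(μ_an, λ_an)(Wd) = (0, 2)`, `X2.O9.ExceptionalLeadingTermAt Wd p`
— the typed exceptional-zero conjecture, OPEN in print for reducible `E[p]` —, `HeegnerFieldWithBernoulliUnit …` — unprinted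
at `p ≥ 5`); closes no registered stub; no summit statement, no Mazur main conjecture and no BSD is proved for any curve;
0 cells / labels / stubs / tiers move.

## What

* §1 `connectedPartner_of_split_of_lamTwo_of_excLT` — ROAD (c) AT A SPLIT X2b PAIR ⟹ the right disjunct: `K` admissible,
  `r_an(E^{(d_K)}) = 1` (a reading — at a split partner the tree has no PUBLISHED `p`-converse), and at every minimal model
  `Wd` of the twist `(μ_an, λ_an) = (0, 2)` + `X2.O9.ExceptionalLeadingTermAt Wd p`; the upper half at `Wd` is LEAD g9's
  p640749 §3(iii) `missingUpperBoundAt_of_cellC_of_split_of_lamMin_of_exceptionalLeadingTerm` (`PublishedInputs` only: under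
  λ-minimality b2b's `X2.exceptionalLeadingTermAt_iff_bsdp_of_lamMin_split`), then p679233 §3 `connectedPartner_of_partnerAt`.
* §2 `connectedPartner_of_ramifiedOdd_of_supply` / `connectedPartner_of_unramifiedEven_of_supply` — SUB-POPULATION (iii)
  (non-split, any odd `p`) with a balance-one line datum and a SUPPLIED field ⟹ the right disjunct: w5 g3's
  `…SubrowPartnerOfSupplyPAdicGZ` §1/§2 (PUBLISHED facts) then `connectedPartner_of_partnerAt`.
* §3 `mazurMainConjectureAt_of_cellB_of_split_of_lamTwo_of_excLT` — Mazur's main conjecture at a SPLIT X2b pair from the road-(c)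
  readings at ONE admissible partner (§1 ∘ p679233 §1; cone = `PublishedInputs` + Mazur Cor. 4.1 + Hsieh + LZZ + Keller–Yin
  Thm. D): the per-pair exit for the 83 split A10 cells that does NOT need a Ш-unit class — one `(0, 2)` reading + the
  exceptional leading term at ONE partner.

References: [MazurTateTeitelbaum1986Invent] §II.10; [SteinWuthrich2013] Thm. 6.1, §4.2; [Wuthrich2014] Thm. 16;
[GreenbergVatsal2000] Thm. (1.3), §3 Thm. (3.11); [Disegni2020] §2.2 Thm. 2.4, §3.2 Thm. 4; [KellerYin2024] Thm. D; tree: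
p640749, p664130, p679233, w5 g3 `…SubrowPartnerOfSupplyPAdicGZ`.
-/

set_option autoImplicit false

-- `Summit.BirchSwinnertonDyer.BirchSwinnertonDyer.…`: the summit and its single sub-problem share a name.
set_option linter.dupNamespace false

noncomputable section

open scoped Classical MatrixGroups ModularForm NumberTheorySymbols

open CongruenceSubgroup WeierstrassCurve NumberField IsDedekindDomain Field
  Literature.NumberTheory.EllipticCurves
  Literature.NumberTheory.GaloisRepresentations
  Literature.NumberTheory.EllipticCurves.ModularForms
  Literature.NumberTheory.QuadraticFields
  Literature.NumberTheory.EllipticCurves.Rank1Residual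
  Literature.NumberTheory.EllipticCurves.Rank1Residual.Typed
  Literature.NumberTheory.EllipticCurves.Wuthrich2014
  Literature.NumberTheory.EllipticCurves.Disegni2020
  Literature.NumberTheory.EllipticCurves.GreenbergVatsal2000
  Literature.NumberTheory.EllipticCurves.KellerYin2024
  Literature.NumberTheory.GaloisCohomology
  Summit.BirchSwinnertonDyer.Rank1Residual
  Summit.BirchSwinnertonDyer.Rank1Residual.X2
  Summit.BirchSwinnertonDyer.BirchSwinnertonDyer.Theses
  Summit.BirchSwinnertonDyer.BirchSwinnertonDyer.Theorems.EisensteinPrimesMazurMCOnCellBTwistbackTwoStepDefs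
  Summit.BirchSwinnertonDyer.BirchSwinnertonDyer.Theorems.EisensteinPrimesMazurMCOnCellBTwistbackFieldSupplyDefs
  Summit.BirchSwinnertonDyer.BirchSwinnertonDyer.Theorems.EisensteinPrimesMazurMCOnCellBTwistbackConnectedPartnerZigzag

namespace Summit.BirchSwinnertonDyer.BirchSwinnertonDyer.Theorems.EisensteinPrimesMazurMCOnCellBTwistbackConnectedPartnerDoors

/-! ## §1. Road (c) at a SPLIT X2b pair is a connected partnered vertex -/

/-- **ROAD (c) AT A SPLIT X2b PAIR ⟹ the right disjunct of the v12 stub.** Data: `X2.CellB W p` with `p` SPLIT for `W`; `K`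
imaginary quadratic, Heegner for `N_W` and `p`, `d_K` odd `< −4`; the reading `ord_{s=1} L(E^{(d_K)}, s) = 1`; and at every
globally minimal model `Wd` of `E^{(d_K)}` the readings `X2.AnalyticMuLE Wd p 0`, `X2.AnalyticLambdaEq Wd p 2` and the typed
exceptional leading term `X2.O9.ExceptionalLeadingTermAt Wd p`. Each `Wd` is X2 (`X2.classX2_twist`), SPLIT at `p` (`p` split
in `K`: `X2.hasSplitMultiplicativeReductionAtPrime_iff_of_smul_eq_quadraticTwist`) and of analytic rank `1` (`analyticRank_smul`),
so p640749 §3(iii) `missingUpperBoundAt_of_cellC_of_split_of_lamMin_of_exceptionalLeadingTerm` gives the upper half at `Wd`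
(`PublishedInputs` only); p679233 §3 `connectedPartner_of_partnerAt` packages the partner AT `W` as a connected partnered vertex
(empty zig-zag). CONDITIONAL on `PublishedInputs` and on the per-pair readings; the exceptional leading term is OPEN in print
for reducible `E[p]`. [cite: MazurTateTeitelbaum1986Invent, §II.10 (hypothesis)] [cite: SteinWuthrich2013, Thm. 6.1 (p. 20), §4.2]
[cite: Wuthrich2014, Thm. 16 (p. 397)] [cite: GreenbergVatsal2000, Thm. (1.3) with pp. 14–15] -/
theorem connectedPartner_of_split_of_lamTwo_of_excLT (hP : EisensteinPrimes.PublishedInputs)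
    (W : WeierstrassCurve ℚ) [W.IsElliptic] [W.IsGloballyMinimal] (p : ℕ) [Fact p.Prime]
    (hc : X2.CellB W p) (hsplit : W.HasSplitMultiplicativeReductionAtPrime p)
    (K : Type) [Field K] [NumberField K] (hK : IsImaginaryQuadratic K)
    (hHN : SatisfiesHeegnerHypothesis (W.conductorNorm ℤ) K) (hHp : SatisfiesHeegnerHypothesis p K)
    (hodd : Odd (NumberField.discr K)) (hlt : NumberField.discr K < -4)
    (hr1 : (W.quadraticTwist (NumberField.discr K : ℚ)).analyticRank = 1)
    (hcert : ∀ (Wd : WeierstrassCurve ℚ) [Wd.IsElliptic] [Wd.IsGloballyMinimal],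
      (∃ C : VariableChange ℚ, C • Wd = W.quadraticTwist (NumberField.discr K : ℚ)) →
      X2.AnalyticMuLE Wd p 0 ∧ X2.AnalyticLambdaEq Wd p 2 ∧ X2.O9.ExceptionalLeadingTermAt Wd p) :
    ∃ (W₁ : WeierstrassCurve ℚ) (_ : W₁.IsElliptic) (_ : W₁.IsGloballyMinimal)
      (U : WeierstrassCurve ℚ) (_ : U.IsElliptic) (_ : U.IsGloballyMinimal)
      (W₀ : WeierstrassCurve ℚ) (_ : W₀.IsElliptic) (_ : W₀.IsGloballyMinimal),
      IsIsogenous W W₁ ∧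
      Relation.ReflTransGen (fun A B : WeierstrassCurve ℚ ↦ TwoStepAt p A B ∨
        (TwoStepAt p B A ∧ ∃ (_ : B.IsElliptic) (_ : B.IsGloballyMinimal), X2.CellB B p)) W₁ U ∧
      IsIsogenous U W₀ ∧
      ∃ (K : Type) (_ : Field K) (_ : NumberField K), IsImaginaryQuadratic K ∧
        SatisfiesHeegnerHypothesis (W₀.conductorNorm ℤ) K ∧ SatisfiesHeegnerHypothesis p K ∧
        Odd (NumberField.discr K) ∧ NumberField.discr K < -4 ∧
        (W₀.quadraticTwist (NumberField.discr K : ℚ)).analyticRank = 1 ∧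
        ∀ (Wd : WeierstrassCurve ℚ) [Wd.IsElliptic] [Wd.IsGloballyMinimal],
          (∃ C : VariableChange ℚ, C • Wd = W₀.quadraticTwist (NumberField.discr K : ℚ)) →
          MissingUpperBoundAt Wd p := by
  have hp2 : p ≠ 2 := hc.2.1.1
  have hmult : W.HasMultiplicativeReductionAtPrime p := hc.2.1.2.2
  refine connectedPartner_of_partnerAt W ⟨K, inferInstance, inferInstance, hK, hHN, hHp, hodd, hlt, hr1, ?_⟩
  intro Wd _ _ hWd
  obtain ⟨C, hC⟩ := hWd
  have hXd : ClassX2 Wd p := X2.classX2_twist W p hc.2.1 K hK hHp Wd ⟨C, hC⟩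
  have hsd : Wd.HasSplitMultiplicativeReductionAtPrime p :=
    (X2.hasSplitMultiplicativeReductionAtPrime_iff_of_smul_eq_quadraticTwist W Wd hK p hp2 hmult hHp hC).mpr hsplit
  have hrd : Wd.analyticRank = 1 := by
    have h := congrArg WeierstrassCurve.analyticRank hC
    rw [analyticRank_smul] at h
    rw [h, hr1]
  obtain ⟨hμ, hlam, hExc⟩ := hcert Wd ⟨C, hC⟩
  exact EisensteinPrimesMazurMCOnCellBTwistbackOnePartnerCertificates.missingUpperBoundAt_of_cellC_of_split_of_lamMin_of_exceptionalLeadingTerm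
    hP Wd p ⟨hrd, hXd⟩ hsd hμ hlam hExc

/-! ## §2. Sub-population (iii) with a supplied field is a connected partnered vertex -/

section Supply

variable (W : WeierstrassCurve ℚ) [W.IsElliptic] [W.IsGloballyMinimal] (p : ℕ) [Fact p.Prime]

/-- **(iii), FIRST shape (line of `E` ramified-odd), SUPPLIED field ⟹ the right disjunct of the v12 stub**: w5 g3's
`…SubrowPartnerOfSupplyPAdicGZ.upperPartner_at_of_ramifiedOdd_of_supply_of_padicGZ` (binders VERBATIM; PUBLISHED facts
`PublishedInputs`, Disegni Thm. 4(1), Greenberg–Vatsal (3.11), Disegni Thm. 2.4; the supply `HeegnerFieldWithBernoulliUnit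
p N_W N₀ d m ψ` as hypothesis) gives a partner AT the pair; `connectedPartner_of_partnerAt` packages it. CONDITIONAL on the
named facts and the supply (unprinted at `p ≥ 5`). [cite: GreenbergVatsal2000, §3 Thm. (3.11) (p. 43) and §2 p. 28]
[cite: Disegni2020, §2.2 Thm. 2.4 and §3.2 Thm. 4] [cite: Wuthrich2014, Thm. 16 (p. 397)] -/
theorem connectedPartner_of_ramifiedOdd_of_supply (hP : EisensteinPrimes.PublishedInputs)
    (hDis : padicBSD_rankOne_nonsplitMult) (h311 : thm311_hasUnitContent_iff_and_order_eq_of_lineRamifiedEven)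
    (hDGZ : padicGrossZagier_nonsplitMult)
    (hc : X2.CellB W p) (hns : ¬ W.HasSplitMultiplicativeReductionAtPrime p)
    {Φ₀ : AddSubgroup (geomTorsion W (p : ℤ))} (hΦ : IsRationalLine W p Φ₀)
    (hram : ¬ LineUnramifiedAt W p Φ₀) (hoddL : LineOdd W p Φ₀)
    {m : ℕ} [NeZero m] (φ : DirichletCharacter (ZMod p) m) {d : ℕ} [NeZero d]
    (ψ : DirichletCharacter (ZMod p) d) (hφ : φ.IsPrimitive) (hψ : ψ.IsPrimitive) (hpm : p ∣ m)
    (hpd : ¬ p ∣ d)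
    (hφ0 : ∀ (σ : absoluteGaloisGroup ℚ), ∀ P ∈ Φ₀,
      σ • P = (φ ((modNCyclotomicCharacter ℚ m σ : (ZMod m)ˣ) : ZMod m)).val • P)
    (hψ0 : ∀ (σ : absoluteGaloisGroup ℚ) (P : geomTorsion W (p : ℤ)),
      σ • P - (ψ ((modNCyclotomicCharacter ℚ d σ : (ZMod d)ˣ) : ZMod d)).val • P ∈ Φ₀)
    (S₀ : Finset (HeightOneSpectrum (𝓞 ℚ))) (hS₀p : ∀ v ∈ S₀, ((p : ℕ) : 𝓞 ℚ) ∉ v.asIdeal)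
    (hS : ∀ v : HeightOneSpectrum (𝓞 ℚ), v ∉ S₀ → ((p : ℕ) : 𝓞 ℚ) ∉ v.asIdeal → W.HasGoodReductionAt v)
    (hbal : 1 + ∑ v ∈ S₀, delta W p v =
      ∑ v ∈ S₀, ((if φ (Rat.HeightOneSpectrum.natGenerator v : ZMod m) =
            (Rat.HeightOneSpectrum.natGenerator v : ZMod p)
          then sFactor p (Rat.HeightOneSpectrum.natGenerator v) else 0) +
        (if ψ (Rat.HeightOneSpectrum.natGenerator v : ZMod d) =
            (Rat.HeightOneSpectrum.natGenerator v : ZMod p)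
          then sFactor p (Rat.HeightOneSpectrum.natGenerator v) else 0)))
    {N₀ : ℕ} (hS₀N₀ : ∀ v ∈ S₀, Rat.HeightOneSpectrum.natGenerator v ∣ N₀)
    (hSup : HeegnerFieldWithBernoulliUnit p (W.conductorNorm ℤ) N₀ d m ψ) :
    ∃ (W₁ : WeierstrassCurve ℚ) (_ : W₁.IsElliptic) (_ : W₁.IsGloballyMinimal)
      (U : WeierstrassCurve ℚ) (_ : U.IsElliptic) (_ : U.IsGloballyMinimal)
      (W₀ : WeierstrassCurve ℚ) (_ : W₀.IsElliptic) (_ : W₀.IsGloballyMinimal),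
      IsIsogenous W W₁ ∧
      Relation.ReflTransGen (fun A B : WeierstrassCurve ℚ ↦ TwoStepAt p A B ∨
        (TwoStepAt p B A ∧ ∃ (_ : B.IsElliptic) (_ : B.IsGloballyMinimal), X2.CellB B p)) W₁ U ∧
      IsIsogenous U W₀ ∧
      ∃ (K : Type) (_ : Field K) (_ : NumberField K), IsImaginaryQuadratic K ∧
        SatisfiesHeegnerHypothesis (W₀.conductorNorm ℤ) K ∧ SatisfiesHeegnerHypothesis p K ∧
        Odd (NumberField.discr K) ∧ NumberField.discr K < -4 ∧
        (W₀.quadraticTwist (NumberField.discr K : ℚ)).analyticRank = 1 ∧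
        ∀ (Wd : WeierstrassCurve ℚ) [Wd.IsElliptic] [Wd.IsGloballyMinimal],
          (∃ C : VariableChange ℚ, C • Wd = W₀.quadraticTwist (NumberField.discr K : ℚ)) →
          MissingUpperBoundAt Wd p :=
  connectedPartner_of_partnerAt W
    (EisensteinPrimesMazurMCOnCellBTwistbackSubrowPartnerOfSupplyPAdicGZ.upperPartner_at_of_ramifiedOdd_of_supply_of_padicGZ
      W p hP hDis h311 hDGZ hc hns hΦ hram hoddL φ ψ hφ hψ hpm hpd hφ0 hψ0 S₀ hS₀p hS hbal hS₀N₀ hSup)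

/-- **(iii), SECOND shape (line of `E` unramified-even), SUPPLIED field ⟹ the right disjunct of the v12 stub**: w5 g3's
`…SubrowPartnerOfSupplyPAdicGZ.upperPartner_at_of_unramifiedEven_of_supply_of_padicGZ` (supply
`HeegnerFieldWithBernoulliUnit p N_W N₀ m d φ`) then `connectedPartner_of_partnerAt`. CONDITIONAL as in the first shape.
[cite: GreenbergVatsal2000, §3 Thm. (3.11) (p. 43) and §2 p. 28] [cite: Disegni2020, §2.2 Thm. 2.4 and §3.2 Thm. 4]
[cite: Wuthrich2014, Thm. 16 (p. 397)] -/
theorem connectedPartner_of_unramifiedEven_of_supply (hP : EisensteinPrimes.PublishedInputs)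
    (hDis : padicBSD_rankOne_nonsplitMult) (h311 : thm311_hasUnitContent_iff_and_order_eq_of_lineRamifiedEven)
    (hDGZ : padicGrossZagier_nonsplitMult)
    (hc : X2.CellB W p) (hns : ¬ W.HasSplitMultiplicativeReductionAtPrime p)
    {Φ₀ : AddSubgroup (geomTorsion W (p : ℤ))} (hΦ : IsRationalLine W p Φ₀)
    (hunr : LineUnramifiedAt W p Φ₀) (heven : LineEven W p Φ₀)
    {m : ℕ} [NeZero m] (φ : DirichletCharacter (ZMod p) m) {d : ℕ} [NeZero d]
    (ψ : DirichletCharacter (ZMod p) d) (hφ : φ.IsPrimitive) (hψ : ψ.IsPrimitive) (hpm : ¬ p ∣ m)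
    (hpd : p ∣ d)
    (hφ0 : ∀ (σ : absoluteGaloisGroup ℚ), ∀ P ∈ Φ₀,
      σ • P = (φ ((modNCyclotomicCharacter ℚ m σ : (ZMod m)ˣ) : ZMod m)).val • P)
    (hψ0 : ∀ (σ : absoluteGaloisGroup ℚ) (P : geomTorsion W (p : ℤ)),
      σ • P - (ψ ((modNCyclotomicCharacter ℚ d σ : (ZMod d)ˣ) : ZMod d)).val • P ∈ Φ₀)
    (S₀ : Finset (HeightOneSpectrum (𝓞 ℚ))) (hS₀p : ∀ v ∈ S₀, ((p : ℕ) : 𝓞 ℚ) ∉ v.asIdeal)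
    (hS : ∀ v : HeightOneSpectrum (𝓞 ℚ), v ∉ S₀ → ((p : ℕ) : 𝓞 ℚ) ∉ v.asIdeal → W.HasGoodReductionAt v)
    (hbal : 1 + ∑ v ∈ S₀, delta W p v =
      ∑ v ∈ S₀, ((if φ (Rat.HeightOneSpectrum.natGenerator v : ZMod m) =
            (Rat.HeightOneSpectrum.natGenerator v : ZMod p)
          then sFactor p (Rat.HeightOneSpectrum.natGenerator v) else 0) +
        (if ψ (Rat.HeightOneSpectrum.natGenerator v : ZMod d) =
            (Rat.HeightOneSpectrum.natGenerator v : ZMod p)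
          then sFactor p (Rat.HeightOneSpectrum.natGenerator v) else 0)))
    {N₀ : ℕ} (hS₀N₀ : ∀ v ∈ S₀, Rat.HeightOneSpectrum.natGenerator v ∣ N₀)
    (hSup : HeegnerFieldWithBernoulliUnit p (W.conductorNorm ℤ) N₀ m d φ) :
    ∃ (W₁ : WeierstrassCurve ℚ) (_ : W₁.IsElliptic) (_ : W₁.IsGloballyMinimal)
      (U : WeierstrassCurve ℚ) (_ : U.IsElliptic) (_ : U.IsGloballyMinimal)
      (W₀ : WeierstrassCurve ℚ) (_ : W₀.IsElliptic) (_ : W₀.IsGloballyMinimal),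
      IsIsogenous W W₁ ∧
      Relation.ReflTransGen (fun A B : WeierstrassCurve ℚ ↦ TwoStepAt p A B ∨
        (TwoStepAt p B A ∧ ∃ (_ : B.IsElliptic) (_ : B.IsGloballyMinimal), X2.CellB B p)) W₁ U ∧
      IsIsogenous U W₀ ∧
      ∃ (K : Type) (_ : Field K) (_ : NumberField K), IsImaginaryQuadratic K ∧
        SatisfiesHeegnerHypothesis (W₀.conductorNorm ℤ) K ∧ SatisfiesHeegnerHypothesis p K ∧
        Odd (NumberField.discr K) ∧ NumberField.discr K < -4 ∧
        (W₀.quadraticTwist (NumberField.discr K : ℚ)).analyticRank = 1 ∧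
        ∀ (Wd : WeierstrassCurve ℚ) [Wd.IsElliptic] [Wd.IsGloballyMinimal],
          (∃ C : VariableChange ℚ, C • Wd = W₀.quadraticTwist (NumberField.discr K : ℚ)) →
          MissingUpperBoundAt Wd p :=
  connectedPartner_of_partnerAt W
    (EisensteinPrimesMazurMCOnCellBTwistbackSubrowPartnerOfSupplyPAdicGZ.upperPartner_at_of_unramifiedEven_of_supply_of_padicGZ
      W p hP hDis h311 hDGZ hc hns hΦ hunr heven φ ψ hφ hψ hpm hpd hφ0 hψ0 S₀ hS₀p hS hbal hS₀N₀ hSup)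

end Supply

/-! ## §3. Road (c) per pair closes Mazur's main conjecture at a SPLIT X2b pair (v12 cone) -/

/-- **Mazur's main conjecture at a SPLIT X2b pair from road (c) at ONE admissible partner** — §1 then LEAD g15's right-disjunct
door p679233 §1 `mazurMainConjectureAt_of_cellB_of_connectedPartner`. Readings per pair: `r_an(E^{(d_K)}) = 1`, and at every
minimal model of the twist `(μ_an, λ_an) = (0, 2)` + `X2.O9.ExceptionalLeadingTermAt`. Named facts BY NAME: `PublishedInputs`,
Poitou–Tate ×2 (hypotheses; tree theorems), Hsieh, LZZ, Mazur Cor. 4.1, Keller–Yin Thm. D (PRE) — the v12 cone. This is the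
per-pair exit for the 83 SPLIT A10 cells that needs NO Ш-unit class; CONDITIONAL; the exceptional leading term for reducible
`E[p]` is OPEN in print, so nothing is closed class-wide and no cell moves by this theorem alone.
[claim: KellerYin2024, status: under-review] [cite: KellerYin2024, Thm. D = Thm. 5.1.3]
[cite: MazurTateTeitelbaum1986Invent, §II.10 (hypothesis)] [cite: SteinWuthrich2013, Thm. 6.1, §4.2] [cite: Miller2011LMS, Def. 1.1] -/
theorem mazurMainConjectureAt_of_cellB_of_split_of_lamTwo_of_excLT (hP : EisensteinPrimes.PublishedInputs)
    (hPT : ∀ (K : Type) [Field K] [NumberField K], poitouTate_selmerStructure_duality K)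
    (hPT2 : ∀ (K : Type) [Field K] [NumberField K], poitouTate_sha_tateDual K)
    (hH : hsieh2014_exists_anticyclotomicPAdicLFunction)
    (hF : LiuZhangZhang2018.thm151_thm153_modularCurve_heegnerVector) (hMaz : mazur_not_dvd_maninConstant_of_odd)
    (hD : KellerYin2024.thmD_imcMult_exists_isBDPLFunction_isTorsion_charIdeal_eq_OPEN)
    (W : WeierstrassCurve ℚ) [W.IsElliptic] [W.IsGloballyMinimal] (p : ℕ) [Fact p.Prime]
    (hc : X2.CellB W p) (hsplit : W.HasSplitMultiplicativeReductionAtPrime p)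
    (K : Type) [Field K] [NumberField K] (hK : IsImaginaryQuadratic K)
    (hHN : SatisfiesHeegnerHypothesis (W.conductorNorm ℤ) K) (hHp : SatisfiesHeegnerHypothesis p K)
    (hodd : Odd (NumberField.discr K)) (hlt : NumberField.discr K < -4)
    (hr1 : (W.quadraticTwist (NumberField.discr K : ℚ)).analyticRank = 1)
    (hcert : ∀ (Wd : WeierstrassCurve ℚ) [Wd.IsElliptic] [Wd.IsGloballyMinimal],
      (∃ C : VariableChange ℚ, C • Wd = W.quadraticTwist (NumberField.discr K : ℚ)) →
      X2.AnalyticMuLE Wd p 0 ∧ X2.AnalyticLambdaEq Wd p 2 ∧ X2.O9.ExceptionalLeadingTermAt Wd p) :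
    X2.MazurMainConjectureAt W p :=
  mazurMainConjectureAt_of_cellB_of_connectedPartner hP hPT hPT2 hH hF hMaz hD W p hc
    (connectedPartner_of_split_of_lamTwo_of_excLT hP W p hc hsplit K hK hHN hHp hodd hlt hr1 hcert)

end Summit.BirchSwinnertonDyer.BirchSwinnertonDyer.Theorems.EisensteinPrimesMazurMCOnCellBTwistbackConnectedPartnerDoors

end
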